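import Mathlib
import Literature.Barriers.ValiantsHypothesis.AlgebraicNaturalProofs
import Summits.ValiantsHypothesis.ValiantsHypothesis.Theorems.BarrierLeverSuccinctHittingSetsForVPPrincipalMinorsTwoFull
import HarnessLib

/-!
# Sylvester's catalecticant rows at the open rung `b = 2` (crux stmt-ValiantsHypothesis-14610 side;
seat val-np-p5)

**What is proved (unconditional; evidence for the open item 14610 in the direction the crux predicts
for rank methods; it does NOT close any item).** Corollaries of `principalMinors_two`
(`…PrincipalMinorsTwoFull.lean`: every principal catalecticant minor is nonsingular at the
central-binomial witness `W_n ∈ SmallCircuits ℂ n 2`, `n ≥ 8192`):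

* `catalecticantDeterminant_two` (tree: `stub_catalecticantDeterminant`, exponent `8`;
  `catalecticantDeterminant_three`, exponent `3`): every square catalecticant block
  `[coeff_{u+w} f]_{|u| = |w| = k}`, `2k ≤ n`, is nonsingular at ONE `f ∈ SmallCircuits ℂ n 2` — it is
  the principal minor on the rows of degree `k`;
* `catalecticantMaximal_two` (tree: `stub_catalecticantMaximal`, exponent `8`;
  `catalecticantMaximal_three`, exponent `3`): every catalecticant `[coeff_{u+w} f]_{|u| = k, |w| ≤ n-k}`,
  `2k ≤ n`, has linearly independent rows at that `f` — already its square block on the columns of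
  degree `k` is nonsingular (`Matrix.eq_zero_of_vecMul_eq_zero`).

Honest framing: `b = 2` hitting-set statements for Sylvester's catalecticant rank method; nothing here
bears on the dense heart of 14610 or on VP ≠ VNP.

References: Sylvester 1851/52; [ForbesShpilkaVolk2018] §1.2, Question 6.
-/

-- layout Summits/ValiantsHypothesis/ValiantsHypothesis forces the duplicated namespace component
set_option linter.dupNamespace false

noncomputable section

namespace Summit.ValiantsHypothesis.ValiantsHypothesis.Theorems.BarrierLever.SuccinctHittingSetsForVP

open Literature.Barriers.ValiantsHypothesis Literature.Computability.AlgebraicComplexity MvPolynomial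

/-- **Sylvester's catalecticant determinants at the open rung `b = 2`**: for `n ≥ 8192` ONE
`f ∈ SmallCircuits ℂ n 2` (the central-binomial witness) has every square catalecticant block
`[coeff_{u+w} f]_{|u| = |w| = k}`, `2k ≤ n`, nonsingular (tree: `stub_catalecticantDeterminant`,
exponent `8`; `catalecticantDeterminant_three`, exponent `3`). [cite: ForbesShpilkaVolk2018, §1.2] -/
theorem catalecticantDeterminant_two :
    ∀ n : ℕ, 8192 ≤ n → ∃ f ∈ SmallCircuits ℂ n 2,
      ∀ (k : ℕ) [Fintype {u : Fin n →₀ ℕ // u.degree = k}], 2 * k ≤ n →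
        (Matrix.of fun u w : {u : Fin n →₀ ℕ // u.degree = k} =>
          MvPolynomial.coeff (u.1 + w.1) f).det ≠ 0 := by
  classical
  intro n hn
  obtain ⟨f, hf, hdet⟩ := principalMinors_two n hn
  refine ⟨f, hf, fun k _ hk => ?_⟩
  exact hdet {u : Fin n →₀ ℕ // u.degree = k} Subtype.val Subtype.val_injective
    (fun u => by rw [u.2]; exact hk)

/-- **Sylvester's catalecticant rank is maximal at the open rung `b = 2`**: for `n ≥ 8192` ONE
`f ∈ SmallCircuits ℂ n 2` has, for every `k` with `2k ≤ n`, linearly independent catalecticant rows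
`u ↦ (w ↦ coeff_{u+w} f)` (`|u| = k`, `|w| ≤ n − k`): the square block on the columns of degree `k`
(`k ≤ n − k`) is already nonsingular (tree: `stub_catalecticantMaximal`, exponent `8`;
`catalecticantMaximal_three`, exponent `3`). [cite: ForbesShpilkaVolk2018, §1.2] -/
theorem catalecticantMaximal_two :
    ∀ n : ℕ, 8192 ≤ n → ∃ f ∈ SmallCircuits ℂ n 2, ∀ k : ℕ, 2 * k ≤ n →
      LinearIndependent ℂ
        (fun u : {u : Fin n →₀ ℕ // u.degree = k} =>
          fun w : {w : Fin n →₀ ℕ // w.degree ≤ n - k} => MvPolynomial.coeff (u.1 + w.1) f) := by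
  classical
  intro n hn
  obtain ⟨f, hf, hdet⟩ := principalMinors_two n hn
  refine ⟨f, hf, fun k hk => ?_⟩
  -- the rows of degree `k` form a finite type
  haveI : Fintype {u : Fin n →₀ ℕ // u.degree = k} := by
    refine Set.Finite.fintype (s := {u : Fin n →₀ ℕ | u.degree = k}) ?_
    refine Set.Finite.subset (Finset.finite_toSet ((Finset.univ : Finset (Fin n)).finsuppAntidiag k))
      fun u hu => ?_
    simp only [Set.mem_setOf_eq] at hu
    rw [Finset.mem_coe, Finset.mem_finsuppAntidiag, ← Finsupp.degree_eq_sum]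
    exact ⟨hu, Finset.subset_univ _⟩
  have hM := hdet {u : Fin n →₀ ℕ // u.degree = k} Subtype.val Subtype.val_injective
    (fun u => by rw [u.2]; exact hk)
  rw [linearIndependent_iff']
  intro s a hsum u₀ hu₀
  -- the relation restricted to the columns of degree `k`
  let v : {u : Fin n →₀ ℕ // u.degree = k} → ℂ := fun u => if u ∈ s then a u else 0
  have hv : Matrix.vecMul v (Matrix.of fun u w : {u : Fin n →₀ ℕ // u.degree = k} =>
      MvPolynomial.coeff (u.1 + w.1) f) = 0 := by
    funext w
    have hw : w.1.degree ≤ n - k := by rw [w.2]; omega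
    have key := congrFun hsum ⟨w.1, hw⟩
    rw [Finset.sum_apply, Pi.zero_apply] at key
    simp only [Pi.smul_apply, smul_eq_mul] at key
    rw [Matrix.vecMul, dotProduct, Pi.zero_apply, ← key]
    rw [← Finset.sum_subset (Finset.subset_univ s) (fun u _ hu => by
      show v u * (Matrix.of fun u w : {u : Fin n →₀ ℕ // u.degree = k} =>
        MvPolynomial.coeff (u.1 + w.1) f) u w = 0
      simp [v, hu])]
    refine Finset.sum_congr rfl fun u hu => ?_
    simp [v, hu]
  have hzero := Matrix.eq_zero_of_vecMul_eq_zero hM hv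
  have := congrFun hzero u₀
  simpa [v, hu₀] using this

end Summit.ValiantsHypothesis.ValiantsHypothesis.Theorems.BarrierLever.SuccinctHittingSetsForVP

end
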